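import Literature.IUT.HodgeTheaters.GaloisCosetFields
import Literature.NumberTheory.NumberFields.RescaledCompletion
import Mathlib.Analysis.Normed.Unbundled.SpectralNorm
import HarnessLib

/-!
# The valued Galois closure of a complete nonarchimedean field, and of `K_v` ([IUTchI] Ex. 3.3 (i) input)

Mochizuki, *Inter-universal Teichmüller Theory I*, kurims manuscript (May 2020), Ex. 3.3 (i) p. 78
[cite: Mochizuki2012, I Ex 3.3 (i) p.78]: "`D⊢_v := 𝓑(K_v)⁰` … `Spec(L) ∈ Ob(D⊢_v)` [i.e., `L` is a finite separable
extension of `K_v`]" — the input `GaloisValDatum` of `GaloisCosetFields.lean` (a `p`-adic local field `k`, a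
Galois extension `Ω/k` carrying a valuation that extends that of `k` and is `Gal(Ω/k)`-invariant) is DISCHARGED here:
* `GaloisValDatum.ofComplete p k` for ANY field `k` complete with respect to a nontrivial nonarchimedean norm and
  finite over `ℚ_p` as a normed algebra: `Ω := k̄` (Mathlib `AlgebraicClosure`) with its SPECTRAL NORM
  (Mathlib `spectralNorm.normedField`; the two "uniqueness of the extension" hypotheses are Mathlib's
  `spectralNorm_extends` and `spectralNorm_eq_of_equiv`; `k̄/k` is Galois in characteristic `0`);
* `GaloisValDatum.ofPlace F p v hv` for a number field `F` and a finite place `v ∣ p`: `k := F_v`, the completion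
  (`v.adicCompletion F` with abc-iut-S7's rescaled norm `‖·‖_v^{1/n_v}` and canonical `ℚ_p`-algebra structure,
  `Literature.NumberTheory.NumberFields.RescaledCompletion`; `[F_v : ℚ_p] = n_v = e_v f_v`).
Hence `GoodLocalFrobenioid.ofGalois` (`GoodLocalFrobenioidOfGalois.lean`) applies at every `v ∈ V̲^good ∩ V̲^non` of an
initial Θ-datum given only the group datum `Π_v ↠ G_v = Gal(K̄_v/K_v)`. Classical background: Neukirch, ANT, Ch. II
(4.8) (uniqueness of the extension to the completion's algebraic closure). [cite: NeukirchANT1999, Ch. II Thm. (4.8)]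
Pure valuation theory over Mathlib and the tree; nothing of the disputed series is asserted.
-/

namespace Literature.IUT.HodgeTheaters

open Literature.AlgebraicGeometry.Frobenioids Literature.AlgebraicGeometry.Frobenioids.PadicFrd
open scoped NNReal

universe u

namespace GaloisValDatum

section Complete

variable (p : ℕ) [Fact p.Prime] (k : Type u) [NontriviallyNormedField k] [CompleteSpace k] [IsUltrametricDist k]
  [NormedAlgebra ℚ_[p] k] [FiniteDimensional ℚ_[p] k]

/-- The valuative relation of a nonarchimedean normed field defined by its norm. [cite: NeukirchANT1999, Ch. II Thm. (4.8)] -/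
@[reducible] noncomputable def normVal : ValuativeRel k := ValuativeRel.ofValuation (NormedField.valuation (K := k))

omit [CompleteSpace k] [NormedAlgebra ℚ_[p] k] [FiniteDimensional ℚ_[p] k] in
/-- `x ≤ᵥ y` iff `‖x‖ ≤ ‖y‖`. [cite: NeukirchANT1999, Ch. II Thm. (4.8)] -/
theorem normVal_iff (x y : k) : @ValuativeRel.vle k _ (normVal k) x y ↔ ‖x‖ ≤ ‖y‖ := Iff.rfl

omit [CompleteSpace k] [IsUltrametricDist k] [FiniteDimensional ℚ_[p] k] in
/-- `‖p‖ < 1` in a normed `ℚ_p`-algebra (`‖p‖_p = p⁻¹`). [cite: NeukirchANT1999, Ch. II Thm. (4.8)] -/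
theorem norm_p_lt_one : ‖((p : ℕ) : k)‖ < 1 := by
  rw [← map_natCast (algebraMap ℚ_[p] k), norm_algebraMap', Padic.norm_p]
  exact inv_lt_one_of_one_lt₀ (by exact_mod_cast (Fact.out : p.Prime).one_lt)

omit [CompleteSpace k] [FiniteDimensional ℚ_[p] k] in
/-- `p ∈ 𝒪^▷_k` for the norm relation. [cite: NeukirchANT1999, Ch. II Thm. (4.8)] -/
theorem p_mem_normVal : ((p : ℕ) : k) ∈ @intNonzero k _ (normVal k) := by
  letI := normVal k
  refine ⟨?_, ?_⟩
  · rw [← (ValuativeRel.valuation k).map_one, ← Valuation.Compatible.vle_iff_le, normVal_iff, norm_one]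
    exact (norm_p_lt_one p k).le
  · rw [← map_natCast (algebraMap ℚ_[p] k)]
    exact (map_ne_zero _).mpr (Nat.cast_ne_zero.mpr (Fact.out : p.Prime).ne_zero)

omit [CompleteSpace k] [FiniteDimensional ℚ_[p] k] in
/-- `v(p) < 1` for the norm relation. [cite: NeukirchANT1999, Ch. II Thm. (4.8)] -/
theorem p_lt_normVal : @ValuativeRel.valuation k _ (normVal k) ((p : ℕ) : k) < 1 := by
  letI := normVal k
  rw [lt_iff_not_ge, ← (ValuativeRel.valuation k).map_one, ← Valuation.Compatible.vle_iff_le, normVal_iff, norm_one,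
    not_le]
  exact norm_p_lt_one p k

/-- The SPECTRAL norm on the algebraic closure `k̄` of the complete field `k` (Mathlib).
[cite: NeukirchANT1999, Ch. II Thm. (4.8)] -/
@[reducible] noncomputable def closureNormedField : NormedField (AlgebraicClosure k) :=
  spectralNorm.normedField k (AlgebraicClosure k)

omit [NormedAlgebra ℚ_[p] k] [FiniteDimensional ℚ_[p] k] in
/-- The spectral norm on `k̄` is nonarchimedean. [cite: NeukirchANT1999, Ch. II Thm. (4.8)] -/
theorem closure_isUltrametricDist :
    @IsUltrametricDist (AlgebraicClosure k) (closureNormedField k).toMetricSpace.toPseudoMetricSpace.toDist := by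
  letI := closureNormedField k
  exact IsUltrametricDist.isUltrametricDist_of_forall_norm_add_le_max_norm
    fun x y => isNonarchimedean_spectralNorm x y

/-- The valuative relation of `k̄` defined by the spectral norm. [cite: NeukirchANT1999, Ch. II Thm. (4.8)] -/
@[reducible] noncomputable def closureVal : ValuativeRel (AlgebraicClosure k) :=
  letI := closureNormedField k
  haveI := closure_isUltrametricDist k
  ValuativeRel.ofValuation (NormedField.valuation (K := AlgebraicClosure k))

omit [NormedAlgebra ℚ_[p] k] [FiniteDimensional ℚ_[p] k] in
/-- `x ≤ᵥ y` in `k̄` iff `spectralNorm x ≤ spectralNorm y`. [cite: NeukirchANT1999, Ch. II Thm. (4.8)] -/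
theorem closureVal_iff (x y : AlgebraicClosure k) :
    @ValuativeRel.vle _ _ (closureVal k) x y ↔
      spectralNorm k (AlgebraicClosure k) x ≤ spectralNorm k (AlgebraicClosure k) y :=
  Iff.rfl

omit [CompleteSpace k] [IsUltrametricDist k] [FiniteDimensional ℚ_[p] k] in
include p in
/-- `k` has characteristic `0` (it contains `ℚ_p`). [cite: NeukirchANT1999, Ch. II Thm. (4.8)] -/
theorem charZero : CharZero k := charZero_of_injective_algebraMap (algebraMap ℚ_[p] k).injective

/-- **The input datum of [IUTchI] Ex. 3.3 (i) for ANY complete nonarchimedean field `k` finite over `ℚ_p`**: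
`Ω := k̄` with its spectral norm — valuation extending that of `k` (`spectralNorm_extends`), `Gal(k̄/k)`-invariant
(`spectralNorm_eq_of_equiv`), `k̄/k` Galois (characteristic `0`), `Spec k` a `p`-adic local field. All inputs
DISCHARGED by Mathlib. [cite: Mochizuki2012, I Ex 3.3 (i) p.78] -/
noncomputable def ofComplete : GaloisValDatum.{u} p :=
  letI := closureNormedField k
  haveI := closure_isUltrametricDist k
  haveI := charZero p k
  { k := k
    valk := normVal k
    Ω := AlgebraicClosure k
    valΩ := closureVal k
    isGalois := inferInstance
    valExt := @ValuativeExtension.mk k (AlgebraicClosure k) _ _ (normVal k) (closureVal k) _ fun a b => by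
      rw [closureVal_iff, normVal_iff, spectralNorm_extends, spectralNorm_extends]
    val_aut := fun σ x y => by
      rw [closureVal_iff, closureVal_iff, ← spectralNorm_eq_of_equiv σ x, ← spectralNorm_eq_of_equiv σ y]
    p_mem := p_mem_normVal p k
    p_lt := p_lt_normVal p k
    isPadicLocal := ⟨⟨(inferInstance : Algebra ℚ_[p] k), (inferInstance : FiniteDimensional ℚ_[p] k),
      fun a b => by
        change @ValuativeRel.vle k _ (normVal k) (algebraMap ℚ_[p] k a) (algebraMap ℚ_[p] k b) ↔ _
        rw [normVal_iff, norm_algebraMap', norm_algebraMap', QuasiTemperoid.padic_vle_iff_norm_le]⟩⟩ }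

/-- The base field of `ofComplete` is `k`. [cite: Mochizuki2012, I Ex 3.3 (i) p.78] -/
theorem ofComplete_k : (ofComplete p k).k = k := rfl

/-- The Galois closure of `ofComplete` is `k̄`. [cite: Mochizuki2012, I Ex 3.3 (i) p.78] -/
theorem ofComplete_Ω : (ofComplete p k).Ω = AlgebraicClosure k := rfl

end Complete

/-! ### At a finite place `v ∣ p` of a number field: `k := F_v` -/

section Place

open Literature.NumberTheory.NumberFields IsDedekindDomain NumberField

variable (F : Type) [Field F] [NumberField F] (p : ℕ) [Fact p.Prime] (v : HeightOneSpectrum (𝓞 F))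
  (hv : ((p : ℕ) : 𝓞 F) ∈ v.asIdeal)

/-- `F_v` is finite over `ℚ_p` (`[F_v : ℚ_p] = n_v > 0`, abc-iut-S7's `localDeg_eq_finrank`).
[cite: NeukirchANT1999, Ch. II Prop. (6.8)] -/
theorem finiteDimensional_rescaledCompletion : FiniteDimensional ℚ_[p] (RescaledCompletion F p v hv) := by
  apply Module.finite_of_finrank_pos
  have h := RescaledCompletion.localDeg_eq_finrank F p v hv
  change localDeg F v = Module.finrank ℚ_[p] (RescaledCompletion F p v hv) at h
  rw [← h]
  exact localDeg_pos F v

/-- **The input datum of [IUTchI] Ex. 3.3 (i) at a finite place `v ∣ p` of a number field `F`**: `k := F_v` (the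
completion, abc-iut-S7's `RescaledCompletion`), `Ω := F̄_v` with the spectral norm — every hypothesis discharged.
[cite: Mochizuki2012, I Ex 3.3 (i) p.78] -/
noncomputable def ofPlace : GaloisValDatum.{0} p :=
  haveI := finiteDimensional_rescaledCompletion F p v hv
  ofComplete p (RescaledCompletion F p v hv)

/-- The base field of `ofPlace` is the completion `F_v`. [cite: Mochizuki2012, I Ex 3.3 (i) p.78] -/
theorem ofPlace_k : (ofPlace F p v hv).k = RescaledCompletion F p v hv := rfl

end Place

end GaloisValDatum

end Literature.IUT.HodgeTheaters
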